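import Summits.BirchSwinnertonDyer.BirchSwinnertonDyer.Theses.KatoDescentPotSupersingular
import Summits.BirchSwinnertonDyer.Rank1Residual.O6.X3KatoMemberBoundOfHullReadings
import Literature.NumberTheory.EllipticCurves.TateModuleStableLatticeMemberProofs
import HarnessLib

/-!
# Route `KatoDescentPotSupersingular` / `KatoDescentTamePotSupersingular`, shared crux `ReducibleKatoMember`
# (item stmt-BirchSwinnertonDyer-19196): Reading M1 ("Kato's member exists") REDUCED TO THE LATTICE —
# the `ℚ`-isogenous member is a THEOREM, only the hull datum at Kato's lattice stays a reading

Cell `bsd-potss`, seat `bsd-potss-rkm` (prover), generation 0; a `--supports` file (the item is NOT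
closed). The crux's `why it might fail` line reads: "Kato Thm. 12.6 bounds `#Ш` of the lattice
`T = V_{ℤ_p}(f)(1)`, i.e. of ONE curve `W_K` in the class; the node asserts `W_K` is `ℚ`-isogenous to
`W` … — unproved when the Manin-type lattice is not a listed member." That step is now the tree
THEOREM `WeierstrassCurve.exists_isIsogenous_isGloballyMinimal_tateModule_equiv_of_stableLattice`
(`Literature/…/TateModuleStableLatticeMemberProofs.lean`, this seat): every `Γ_ℚ`-stable `ℤ_p`-lattice
`p^nT_pW ⊆ L ⊆ T_pW` is, `Γ_ℚ`-equivariantly, the Tate module of a GLOBALLY MINIMAL curve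
`ℚ`-isogenous to `W` (Silverman *AEC* III.4.12 / Rem. III.4.13.2 + III.§7 + VIII.8.3). Accordingly
the hull reading M1 of `O6/X3KatoMemberBoundOfHullReadings.lean` (seat kmc, part 12) —
`KatoHull.MemberRealizable IsHullOf`: "a `ℚ`-isogenous globally minimal `W'` carrying a realised hull
datum exists" — follows from the strictly smaller LATTICE READING (displayed inline as the hypothesis `hL`):
"some `Γ_ℚ`-stable lattice `L` of `T_pW` commensurable with `T_pW` (Kato's `V_{ℤ_p}(f)(1)`, scaled into
`T_pW`; Kato 8.3 / 6.3) is such that EVERY globally minimal `W' ∼_ℚ W` with `T_pW' ≅ L`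
`Γ_ℚ`-equivariantly carries a realised hull datum" (`memberRealizable_of_latticeReading`), and the
crux follows from the lattice reading + M2 + M3 (`reducibleKatoMember_of_latticeReading`).
What moved: the EXISTENCE OF THE MEMBER is kernel; what did not: which lattice is Kato's and that its
§14.14 data form a hull datum (the D-O6-2″ realisation of `IsHullOf`), and the readings M2/M3.
Nothing about Kato's objects is asserted; conditional (audit `proof.conditional`).

References: K. Kato, Astérisque 295 (2004) 8.3 (p. 181), Thm. 12.4 (p. 221), Thm. 12.6 (p. 222), 13.14
(p. 234), §14.14 (p. 243), 17.5 (p. 274) [Kato2004Asterisque]; C. Wuthrich, Doc. Math. 19 (2014) §3.2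
(p. 394) [Wuthrich2014]; J. H. Silverman, *AEC* Prop. III.4.12, Rem. III.4.13.2, III.§7, Cor. VIII.8.3
[SilvermanAEC2009].
-/

set_option autoImplicit false
-- sibling precedent (`KatoDescentPotSupersingularAssembly.lean`): the directory name repeats the summit name
set_option linter.dupNamespace false

noncomputable section

open scoped Classical

namespace Summit.BirchSwinnertonDyer.BirchSwinnertonDyer.Theorems

open WeierstrassCurve Field Literature.NumberTheory.EllipticCurves
  Summit.BirchSwinnertonDyer.Rank1Residual Summit.BirchSwinnertonDyer.Rank1Residual.Additive

namespace ReducibleKatoMember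

variable {IsHullOf : ∀ (W : WeierstrassCurve ℚ) [W.IsElliptic] [W.IsGloballyMinimal] (p : ℕ)
  [Fact p.Prime], KatoHullDescentDatum p → Prop}

/-- **Kato's member EXISTS: the LATTICE reading M1′ implies Reading M1 (`KatoHull.MemberRealizable`).**
The hypothesis `hL` is the lattice reading, displayed inline (a hypothesis schema, strictly smaller
than M1): for `W/ℚ` globally minimal, `p ≠ 2` additive potentially good with `W[p]` reducible, there is
a `Γ_ℚ`-stable `ℤ_p`-submodule `L ⊆ T_pW` containing some `p^nT_pW` (intended: Kato's lattice
`V_{ℤ_p}(f)(1) ⊂ V_pW`, Kato 8.3 / 6.3 / 17.5, scaled into `T_pW`) such that EVERY globally minimal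
elliptic `W' ∼_ℚ W` whose Tate module is `Γ_ℚ`-equivariantly `ℤ_p`-isomorphic to `L` carries a
realised hull datum `IsHullOf W' p D` (Kato's §14.14 data of `T_pW' ≅ V_{ℤ_p}(f)(1)` with the zeta
element in the reflexive hull: Thm. 12.4, Thm. 12.6 + 13.14, (14.14.1)). The EXISTENCE of such a `W'`
is not part of the reading: it is the tree theorem
`WeierstrassCurve.exists_isIsogenous_isGloballyMinimal_tateModule_equiv_of_stableLattice` (every
`Γ_ℚ`-stable lattice `p^nT_pW ⊆ L ⊆ T_pW` is the Tate module of a globally minimal `ℚ`-isogenous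
curve: Silverman *AEC* III.4.12 / Rem. III.4.13.2, III.§7, VIII.8.3), which discharges the crux's
recorded `why it might fail` ("`W_K` is `ℚ`-isogenous to `W` — unproved") in the kernel. Nothing about
Kato's objects is asserted.
[cite: SilvermanAEC2009, Prop. III.4.12 with Rem. III.4.13.2, III.7 and Cor. VIII.8.3]
[cite: Kato2004Asterisque, 8.3 (p. 181), Thm. 12.4 (p. 221), Thm. 12.6 (p. 222), 13.14 (p. 234), §14.14 (p. 243), 17.5 (p. 274)]
[cite: Wuthrich2014, §3.2 (p. 394)] -/
theorem memberRealizable_of_latticeReading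
    (hL : ∀ (W : WeierstrassCurve ℚ) [W.IsElliptic] [W.IsGloballyMinimal] (p : ℕ) [Fact p.Prime],
      p ≠ 2 → Rank1Residual.Addv W p → 0 ≤ padicValRat p W.j → ¬ W.HasIrreducibleModPGaloisRep p →
      ∃ (L : Submodule ℤ_[p] (W.tateModule p))
        (hGal : ∀ (σ : absoluteGaloisGroup ℚ) (a : W.tateModule p), a ∈ L → σ • a ∈ L),
        (∃ n : ℕ, ∀ a : W.tateModule p, (p : ℤ_[p]) ^ n • a ∈ L) ∧
        ∀ (W' : WeierstrassCurve ℚ) [W'.IsElliptic] [W'.IsGloballyMinimal],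
          IsIsogenous W W' →
          (∃ e : L ≃ₗ[ℤ_[p]] W'.tateModule p,
            ∀ (σ : absoluteGaloisGroup ℚ) (a : W.tateModule p) (ha : a ∈ L),
              e ⟨σ • a, hGal σ a ha⟩ = σ • e ⟨a, ha⟩) →
          ∃ D : KatoHullDescentDatum p, IsHullOf W' p D) :
    KatoHull.MemberRealizable IsHullOf := by
  intro W _ _ p _ hp hadd hj hred
  obtain ⟨L, hGal, ⟨n, hn⟩, hreal⟩ := hL W p hp hadd hj hred
  obtain ⟨W', hE', hM', e, hiso, he⟩ :=
    W.exists_isIsogenous_isGloballyMinimal_tateModule_equiv_of_stableLattice p L hGal hn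
  haveI := hE'
  haveI := hM'
  obtain ⟨D, hD⟩ := hreal W' hiso ⟨e, he⟩
  exact ⟨W', hE', hM', hiso, D, hD⟩

/-- **The crux `ReducibleKatoMember` from the LATTICE reading M1′ and the hull readings M2, M3**
(type = the route decl verbatim): `memberRealizable_of_latticeReading` feeds seat kmc's
`O6.katoMemberShaBoundOfReducible_of_hullReadings` (part 12). Conditional over the displayed
readings; the residue of the crux is exactly: WHICH lattice is Kato's and that its §14.14 data with
the zeta element in the hull form a `KatoHullDescentDatum` (M1′), the height-one divisibility for the
hull on the reducible rows (M2: Kato 12.5 (3) off `(p)`, Wuthrich 2014 Lemma 14 at `(p)`), and the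
rank-`0` count at a member with `p`-torsion (M3: Prop. 14.16 (2) + Lemma T + the additive local
index). The item is not closed by this theorem.
[cite: Kato2004Asterisque, Thm. 12.6 (p. 222), 13.14 (p. 234), §14.14 and Lemma 14.15 (pp. 243–244), Prop. 14.16 (2) (p. 244)]
[cite: Wuthrich2014, Lemma 11, Lemma 12 (pp. 394–395), Lemma 14 (p. 396)] -/
theorem reducibleKatoMember_of_latticeReading
    (hL : ∀ (W : WeierstrassCurve ℚ) [W.IsElliptic] [W.IsGloballyMinimal] (p : ℕ) [Fact p.Prime],
      p ≠ 2 → Rank1Residual.Addv W p → 0 ≤ padicValRat p W.j → ¬ W.HasIrreducibleModPGaloisRep p →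
      ∃ (L : Submodule ℤ_[p] (W.tateModule p))
        (hGal : ∀ (σ : absoluteGaloisGroup ℚ) (a : W.tateModule p), a ∈ L → σ • a ∈ L),
        (∃ n : ℕ, ∀ a : W.tateModule p, (p : ℤ_[p]) ^ n • a ∈ L) ∧
        ∀ (W' : WeierstrassCurve ℚ) [W'.IsElliptic] [W'.IsGloballyMinimal],
          IsIsogenous W W' →
          (∃ e : L ≃ₗ[ℤ_[p]] W'.tateModule p,
            ∀ (σ : absoluteGaloisGroup ℚ) (a : W.tateModule p) (ha : a ∈ L),
              e ⟨σ • a, hGal σ a ha⟩ = σ • e ⟨a, ha⟩) →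
          ∃ D : KatoHullDescentDatum p, IsHullOf W' p D)
    (hD : KatoHull.DivisibilityReading IsHullOf) (hC : KatoHull.CountReading IsHullOf) :
    Summit.BirchSwinnertonDyer.BirchSwinnertonDyer.Theses.KatoDescentPotSupersingular.ReducibleKatoMember :=
  O6.katoMemberShaBoundOfReducible_of_hullReadings (memberRealizable_of_latticeReading hL) hD hC

end ReducibleKatoMember

end Summit.BirchSwinnertonDyer.BirchSwinnertonDyer.Theorems

end
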